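import Summits.AtomisticToContinuum.FouriersLaw.Theorems.BondHeatUncertaintyBoundedResponseBathHeatHorizonReturnC
import HarnessLib

/-!
# BondHeatUncertainty / BoundedResponse — «HorizonReturn» §6: the horizon heat-return curve through NODE 110's energy response curves;
`(HM)` ⟸ CONFINED pointwise `(ER↑)` WITHIN THE HORIZON; the ladder of NODE 112 (part 4 of 5 — overview in the main file `…BathHeatHorizonReturn`)

§6 `horizonReturnProfile_eq_setIntegral`: `𝔊^{s,t;τ}_N(k) = ∫_{(0,τ]} ℓ_{s,t}(u)·(Ḡ_{N,u}(k) − T) du` (`N = n+1`); `horizonReturnProfile_monoOn_of_kinKickProfile_monoOn`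
(confined, horizon-restricted comparison: pointwise `k²`-monotonicity of every `Ḡ_{N,u}`, `s < u ≤ τ`, on `k² ≤ X` gives that of `𝔊^{s,t;τ}_N` on `k² ≤ X`);
★ `horizonReturnMonotoneOn_of_kinKickProfile_monoOn` (the instrumentable sufficient condition: census KICK readouts `Ḡ_{N,u}(k)`, `aN < u ≤ N^q`,
`k² ≤ T·N^δ`); `horizonReturnLadder`. No `sorry`, no new axioms.
-/

noncomputable section

open MeasureTheory ProbabilityTheory Filter Topology Set Function
open scoped NNReal ENNReal
open Literature.MathematicalPhysics.KineticTheory.HeatConduction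
open Literature.MathematicalPhysics.KineticTheory OscillatorChain
open Literature.Probability.Process
open Summit.AtomisticToContinuum.FouriersLaw.Theorems.OddSectorIrreversibility
  (pinnedChain_stronglyMeasurable_act_uncurry pinnedChain_integral_sq_act_le_of_stronglyMeasurable
    pinnedChain_integrable_transitionKernel_of_abs_le integral_exp_neg_mul_Ioi' integrable_mul_of_integrable_sq)
open Summit.AtomisticToContinuum.FouriersLaw.Theorems.BoundedResponse.ParityFloor
  (kinObs kinAct continuous_kinObs abs_kinObs_le stronglyMeasurable_kinAct abs_kinAct_le kinAct_integrableOn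
    harrisBound_exists weight_facts kinObs_sq_facts)

namespace Summit.AtomisticToContinuum.FouriersLaw.Theorems.BoundedResponse.HeatSpreading

/-! ## §6 The horizon curve through NODE 110's energy response curves; `(HM)` ⟸ CONFINED `(ER↑)` WITHIN THE HORIZON (instrumentable form) -/

section ProfileFormula

variable {ω₂ lam β γ : ℝ} {T : ℝ} (hω : 0 < ω₂) (hl : 0 < lam) (hβ : 0 < β) (hγ : 0 < γ) (hT : 0 < T)
include hω hl hβ hγ hT

/-- ★ **`𝔊^{s,t;τ}_N(k) = ∫_{(0,τ]} ℓ_{s,t}(u)·(Ḡ_{N,u}(k) − T) du` for EVERY `k`** (`Ḡ` = NODE 110's `kinKickProfile`, the census KICK curve):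
the horizon heat-return curve is the late-weighted time integral, up to the horizon, of the centred energy response curves. [this cell] -/
theorem horizonReturnProfile_eq_setIntegral (n : ℕ) (s t τ k : ℝ) :
    horizonReturnProfile ω₂ lam β γ T (n + 1) s t τ k =
      ∫ u in Ioc (0 : ℝ) τ, lateWeight s t u * (kinKickProfile ω₂ lam β γ T (n + 1) u k - T) := by
  obtain ⟨ϑ, hϑ⟩ : ∃ ϑ : ℝ, ϑ = 1 / (4 * T) := ⟨_, rfl⟩
  obtain ⟨hϑ0, h2ϑ, hϑ1⟩ : 0 < ϑ ∧ 2 * ϑ < 1 / T ∧ ϑ < 1 / T := by rw [hϑ]; exact weight_facts hT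
  obtain ⟨K, c, hK0, hc, hb⟩ := harrisBound_exists hω hl.le hβ hγ (Nat.succ_pos n) hT hϑ0 hϑ1
  haveI : IsProbabilityMeasure ((pinnedChain ω₂ lam β γ).gibbsMeasure (n + 1) T) :=
    pinnedChain_isProbabilityMeasure_gibbsMeasure hω hl.le hβ.le γ (n + 1) hT
  have hφ := measurable_kickMomentum n k
  haveI : IsProbabilityMeasure (((pinnedChain ω₂ lam β γ).gibbsMeasure (n + 1) T).map
      (fun z : PhaseSpace (n + 1) => ((z.1, Function.update z.2 0 k) : PhaseSpace (n + 1)))) :=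
    Measure.isProbabilityMeasure_map hφ.aemeasurable
  -- the kick pushforward integrates `e^{2ϑH}`
  have h2ϑ0 : 0 ≤ 2 * ϑ := by positivity
  have hcontE : Continuous fun y : PhaseSpace (n + 1) => Real.exp (2 * ϑ * (pinnedChain ω₂ lam β γ).hamiltonian (n + 1) y) :=
    Real.continuous_exp.comp (continuous_const.mul (pinnedChain_continuous_hamiltonian ω₂ lam β γ (n + 1)))
  have hν2 : Integrable (fun y => Real.exp (2 * ϑ * (pinnedChain ω₂ lam β γ).hamiltonian (n + 1) y))
      (((pinnedChain ω₂ lam β γ).gibbsMeasure (n + 1) T).map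
        (fun z : PhaseSpace (n + 1) => ((z.1, Function.update z.2 0 k) : PhaseSpace (n + 1)))) := by
    rw [integrable_map_measure hcontE.aestronglyMeasurable hφ.aemeasurable]
    exact (integrable_kick_of_abs_le hω hl hβ hT h2ϑ0 h2ϑ hcontE.stronglyMeasurable (C := 1)
      (fun y => by rw [abs_of_pos (Real.exp_pos _), one_mul]) k).1
  -- weighted Fubini on the pushforward with `F ≡ 1` and the horizon-cut weight `𝟙_{(−∞,τ]}·ℓ`
  have hwm : Measurable ((Iic τ).indicator (lateWeight s t)) := (continuous_lateWeight s t).measurable.indicator measurableSet_Iic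
  have hwb : ∀ u : ℝ, 0 < u → |(Iic τ).indicator (lateWeight s t) u| ≤ |t| + 4 * |s| := by
    intro u hu
    by_cases hu' : u ∈ Iic τ
    · rw [indicator_of_mem hu']; exact abs_lateWeight_le s t hu.le
    · rw [indicator_of_notMem hu', abs_zero]; positivity
  have hF := integral_mul_setIntegral_weight_kinAct hω hl.le hβ.le hγ.le hT hϑ0 hK0.le hb hc 0 _ hν2
    stronglyMeasurable_const (F := fun _ => (1 : ℝ)) (by simp only [one_pow]; exact integrable_const 1) hwm hwb
  simp only [one_mul] at hF
  have e2 : horizonCumFcast ω₂ lam β γ T (n + 1) s t τ =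
      fun z => ∫ u in Ioi (0 : ℝ), (Iic τ).indicator (lateWeight s t) u * kinAct ω₂ lam β γ T (n + 1) 0 u z := by
    funext z
    rw [horizonCumFcast_succ, setIntegral_Ioc_eq_Ioi_indicator]
    refine setIntegral_congr_fun measurableSet_Ioi fun u _ => ?_
    rw [Set.indicator_mul_left]
  rw [horizonReturnProfile_succ]
  unfold kickAvg
  rw [integral_kick_eq_integral_map ω₂ lam β γ T (horizonCumFcast ω₂ lam β γ T (n + 1) s t τ)
    (stronglyMeasurable_horizonCumFcast hω hl hβ hγ n s t τ) k, e2]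
  rw [hF, setIntegral_Ioc_eq_Ioi_indicator]
  refine setIntegral_congr_fun measurableSet_Ioi (fun u _ => ?_)
  rw [Set.indicator_mul_left]
  show (Iic τ).indicator (lateWeight s t) u * _ = (Iic τ).indicator (lateWeight s t) u * _
  congr 1
  rw [← kickAvg_kinAct_eq hω hl hβ hγ hT n u k]
  unfold kickAvg
  exact (integral_kick_eq_integral_map ω₂ lam β γ T (kinAct ω₂ lam β γ T (n + 1) 0 u)
    (stronglyMeasurable_kinAct ω₂ lam β γ T 0 u) k).symm

/-- ★ **CONFINED COMPARISON WITH NODE 110**: if within the horizon (`u ≤ τ`) and past the blind window (`u > s`) every energy response curve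
`Ḡ_{N,u}` is nondecreasing in the injected energy ON `k² ≤ X`, then so is `𝔊^{s,t;τ}_N` on `k² ≤ X` (`0 ≤ s`, `2s ≤ t`, so `ℓ_{s,t} ≥ 0`).
Echo timing is irrelevant; hard kicks `k² > X` are irrelevant; lags `u > τ` are irrelevant. [this cell] -/
theorem horizonReturnProfile_monoOn_of_kinKickProfile_monoOn (n : ℕ) {s t τ X : ℝ} (hs : 0 ≤ s) (hst : 2 * s ≤ t)
    (hmono : ∀ u : ℝ, s < u → u ≤ τ → ∀ k₁ k₂ : ℝ, k₁ ^ 2 ≤ k₂ ^ 2 → k₂ ^ 2 ≤ X →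
      kinKickProfile ω₂ lam β γ T (n + 1) u k₁ ≤ kinKickProfile ω₂ lam β γ T (n + 1) u k₂)
    (k₁ k₂ : ℝ) (hk : k₁ ^ 2 ≤ k₂ ^ 2) (hX : k₂ ^ 2 ≤ X) :
    horizonReturnProfile ω₂ lam β γ T (n + 1) s t τ k₁ ≤ horizonReturnProfile ω₂ lam β γ T (n + 1) s t τ k₂ := by
  have hst' : s ≤ t := by linarith
  rw [horizonReturnProfile_eq_setIntegral hω hl hβ hγ hT n s t τ k₁, horizonReturnProfile_eq_setIntegral hω hl hβ hγ hT n s t τ k₂]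
  have hI : ∀ k : ℝ, IntegrableOn (fun u : ℝ => lateWeight s t u * (kinKickProfile ω₂ lam β γ T (n + 1) u k - T)) (Ioc 0 τ) :=
    fun k => (integrableOn_lateWeight_mul_kinKickProfile_sub hω hl hβ hγ hT n s t k).mono_set Ioc_subset_Ioi_self
  refine setIntegral_mono_on (hI k₁) (hI k₂) measurableSet_Ioc (fun u hu => ?_)
  by_cases hsu : s < u
  · exact mul_le_mul_of_nonneg_left (sub_le_sub_right (hmono u hsu hu.2 k₁ k₂ hk hX) T) (lateWeight_nonneg hs hst hu.1.le)
  · have hus : u ≤ s := not_lt.1 hsu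
    rw [lateWeight_eq_zero hs hus (hus.trans hst'), zero_mul, zero_mul]

end ProfileFormula

/-- ★ **`(HM_{a,q,δ})` ⟸ CONFINED POINTWISE `(ER↑)` WITHIN THE HORIZON, PAST THE BLIND WINDOW** — the instrumentable sufficient condition
(census KICK readouts): eventually in `N`, for every lag `aN < u ≤ N^q` and all kicks `k₁² ≤ k₂² ≤ T·N^δ`,
`Ḡ_{N,u}(k₁) ≤ Ḡ_{N,u}(k₂)` (NODE 110's energy response curve, `kinKickProfile`). [this cell] -/
theorem horizonReturnMonotoneOn_of_kinKickProfile_monoOn {a δ : ℝ} {q : ℕ} (ha : 0 ≤ a)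
    (h : ∀ ω₂ lam β γ : ℝ, 0 < ω₂ → 0 < lam → 0 < β → 0 < γ → ∀ T : ℝ, 0 < T →
      ∃ N₀ : ℕ, ∀ N : ℕ, N₀ ≤ N → ∀ u : ℝ, a * N < u → u ≤ (N : ℝ) ^ q → ∀ k₁ k₂ : ℝ, k₁ ^ 2 ≤ k₂ ^ 2 →
        k₂ ^ 2 ≤ T * (N : ℝ) ^ δ → kinKickProfile ω₂ lam β γ T N u k₁ ≤ kinKickProfile ω₂ lam β γ T N u k₂) :
    HorizonReturnMonotoneOn a q δ := by
  intro ω₂ lam β γ hω hl hβ hγ T hT c hc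
  obtain ⟨N₀, hN₀⟩ := h ω₂ lam β γ hω hl hβ hγ T hT
  refine ⟨N₀ + ⌈2 * a / c⌉₊ + 1, fun N hN => ⟨_, fun k₁ k₂ hk hX => ?_, Eventually.of_forall fun k => rfl⟩⟩
  obtain ⟨n, rfl⟩ : ∃ n, N = n + 1 := ⟨N - 1, by omega⟩
  have hs : 0 ≤ a * ((n + 1 : ℕ) : ℝ) := by positivity
  have hNc : 2 * a / c ≤ ((n + 1 : ℕ) : ℝ) :=
    (Nat.le_ceil _).trans (by exact_mod_cast (show ⌈2 * a / c⌉₊ ≤ n + 1 by omega))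
  have hst : 2 * (a * ((n + 1 : ℕ) : ℝ)) ≤ c * ((n + 1 : ℕ) : ℝ) ^ 2 := by
    have hN0 : (0 : ℝ) ≤ ((n + 1 : ℕ) : ℝ) := by positivity
    have h2 : 2 * a ≤ ((n + 1 : ℕ) : ℝ) * c := by rwa [div_le_iff₀ hc] at hNc
    nlinarith
  exact horizonReturnProfile_monoOn_of_kinKickProfile_monoOn hω hl hβ hγ hT n hs hst
    (fun u hu huτ k₁' k₂' hk' hX' => hN₀ (n + 1) (by omega) u hu huτ k₁' k₂' hk' hX') k₁ k₂ hk hX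

/-- **LADDER OF NODE 112** (every arrow PROVED; `0 ≤ a`, `3 ≤ q`, `0 < δ`): confined pointwise `(ER↑)` within the horizon ⟹ `(HM_{a,q,δ})`;
`(HZᶠ_{q,q+2})` free; `(HZᶠ_{q,1}) ∧ (HM_{a,q,δ}) ⟹ LateTailFloor a 1 1 ⟹` (with (S)) the blocker 11071. [this cell] -/
theorem horizonReturnLadder {a δ : ℝ} {q : ℕ} (ha : 0 ≤ a) (hq : 3 ≤ q) (hδ : 0 < δ) :
    HorizonRemainderFloor q ((q : ℝ) + 2) ∧
    (HorizonRemainderFloor q 1 → HorizonReturnMonotoneOn a q δ → LateTailFloor a 1 1) ∧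
    (Theses.BondHeatUncertainty.SubdiffusiveBondHeat → HorizonRemainderFloor q 1 → HorizonReturnMonotoneOn a q δ →
      Theses.BondHeatUncertainty.BoundedResponse) :=
  ⟨horizonRemainderFloor_free q, lateTailFloor_one_of_horizon ha hq hδ,
    fun hS hZ hM => boundedResponse_of_subdiffusiveBondHeat_horizon ha hq hδ hS hZ hM⟩

end Summit.AtomisticToContinuum.FouriersLaw.Theorems.BoundedResponse.HeatSpreading

end
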